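import Literature.Geometry.Kaehler.ChartOps
import Literature.Analysis.FunctionSpaces.TorusFirstOrderOps
import Literature.Analysis.Complex.DbarAlongHolomorphic
import HarnessLib

/-!
# Transfer of first-order operators to periodic operators on the torus (Warner 6.31–6.32)

F. W. Warner, *Foundations of Differentiable Manifolds and Lie Groups*, GTM 94 (1983), 6.31
("Choose a neighborhood `O₀` … small enough so that there exists a periodic elliptic operator
`L̃` which agrees with `L` on `O₀`") and 6.32. For an operator `op` on forms of `M` read in the
chart at `p` by `Q : ChartOp1` (`ChartOps`), we build a first-order periodic operator
`Q.toFOp1 … : Torus.FOp1 (Fin n) V W` on the flat torus (`TorusFirstOrderOps`) whose constant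
part is `Q` frozen at the chart point and whose variable part is the cut-off, periodised
difference, and prove that it **agrees with `op` through the torus transfer**:
`T (op β) = (Q.toFOp1 …) (T β)` for smooth forms `β` supported in the cube region `K_ρ`
(`ChartOp1.Represents.toTorus_apply`), together with the smallness of the variable part
(`ChartOp1.norm_toFOp1_p_le`).

## References

* F. W. Warner, GTM 94 (1983), 6.31, 6.32. [WarnerGTM94]
-/

noncomputable section

open scoped Manifold ContDiff Topology
open Bundle Set Filter Function Metric Module
open Literature.Analysis.FunctionSpaces

set_option maxSynthPendingDepth 2
set_option synthInstance.maxHeartbeats 100000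

namespace Literature.Geometry.Kaehler

/-! ### Real-linear maps commuting with `i` (`ContinuousLinearMap.complexOfCommuteI` of `DbarAlongHolomorphic`) -/

section ComplexUpgrade

variable {V W : Type*} [NormedAddCommGroup V] [NormedSpace ℂ V] [NormedAddCommGroup W] [NormedSpace ℂ W]

/-- Restricting the scalars of the upgrade gives back the map. [folklore] -/
theorem _root_.ContinuousLinearMap.restrictScalars_complexOfCommuteI (f : V →L[ℝ] W)
    (hf : ∀ v, f (Complex.I • v) = Complex.I • f v) : (f.complexOfCommuteI hf).restrictScalars ℝ = f := by
  ext v; rfl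

/-- **Smoothness of a family of upgrades** (finite-dimensional spaces): if `x ↦ g x` is `C^∞`
with values in real-linear maps each commuting with `i`, the family of complex-linear upgrades
is `C^∞` (restriction of scalars is an injective linear map with a continuous left inverse).
[folklore] -/
theorem contDiffOn_complexOfCommuteI [FiniteDimensional ℝ V] [FiniteDimensional ℝ W]
    {X : Type*} [NormedAddCommGroup X] [NormedSpace ℝ X] {g : X → (V →L[ℝ] W)} {s : Set X}
    (hg : ContDiffOn ℝ ∞ g s) (h : ∀ x v, g x (Complex.I • v) = Complex.I • g x v) :
    ContDiffOn ℝ ∞ (fun x ↦ (g x).complexOfCommuteI (h x)) s := by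
  haveI : FiniteDimensional ℝ (V →L[ℝ] W) := ContinuousLinearMap.finiteDimensional
  set Ψ : (V →L[ℂ] W) →ₗ[ℝ] (V →L[ℝ] W) := ContinuousLinearMap.restrictScalarsₗ ℂ V W ℝ ℝ with hΨ
  have hinj : LinearMap.ker Ψ = ⊥ := by
    rw [LinearMap.ker_eq_bot]
    intro f f' hff'
    ext v
    have := congrArg (fun e : V →L[ℝ] W ↦ e v) hff'
    simpa [hΨ] using this
  obtain ⟨Λ₀, hΛ₀⟩ := Ψ.exists_leftInverse_of_injective hinj
  set Λc : (V →L[ℝ] W) →L[ℝ] (V →L[ℂ] W) := ⟨Λ₀, LinearMap.continuous_of_finiteDimensional _⟩ with hΛc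
  have heq : (fun x ↦ (g x).complexOfCommuteI (h x)) = fun x ↦ Λc (g x) := by
    funext x
    have h1 : Λ₀ (Ψ ((g x).complexOfCommuteI (h x))) = (g x).complexOfCommuteI (h x) := congr($hΛ₀ _)
    have h2 : Ψ ((g x).complexOfCommuteI (h x)) = g x := by
      rw [hΨ, ContinuousLinearMap.coe_restrictScalarsₗ]
      exact (g x).restrictScalars_complexOfCommuteI (h x)
    rw [h2] at h1
    exact h1.symm
  rw [heq]
  exact Λc.contDiff.comp_contDiffOn hg

end ComplexUpgrade

/-! ### Cut-off products -/

section Cutoff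

variable {X Y : Type*} [NormedAddCommGroup X] [NormedSpace ℝ X] [NormedAddCommGroup Y] [NormedSpace ℝ Y]

/-- A smooth cut-off function times a function smooth on an open set containing the closed support
of the cut-off is smooth everywhere. [folklore] -/
theorem contDiff_smul_of_tsupport_subset {χ : X → ℝ} {f : X → Y} {O : Set X} (hO : IsOpen O)
    (hχ : ContDiff ℝ ∞ χ) (hs : tsupport χ ⊆ O) (hf : ContDiffOn ℝ ∞ f O) :
    ContDiff ℝ ∞ (fun z ↦ χ z • f z) := by
  refine contDiff_iff_contDiffAt.2 fun z ↦ ?_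
  by_cases hz : z ∈ O
  · exact hχ.contDiffAt.smul (hf.contDiffAt (hO.mem_nhds hz))
  · have hzs : z ∉ tsupport χ := fun h ↦ hz (hs h)
    have hev : (fun z ↦ χ z • f z) =ᶠ[𝓝 z] fun _ ↦ 0 := by
      filter_upwards [(isClosed_tsupport χ).isOpen_compl.mem_nhds hzs] with z' hz'
      rw [image_eq_zero_of_notMem_tsupport hz', zero_smul]
    exact contDiffAt_const.congr_of_eventuallyEq hev

omit [NormedSpace ℝ X] in
/-- The norm of a cut-off product is bounded by the bound on the cut-off times the bound on the
function over the closed support of the cut-off. [folklore] -/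
theorem norm_smul_le_of_tsupport {χ : X → ℝ} {f : X → Y} {K : Set X} (hs : tsupport χ ⊆ K)
    {a b : ℝ} (ha : 0 ≤ a) (hb : 0 ≤ b) (hχ : ∀ z, |χ z| ≤ a) (hf : ∀ z ∈ K, ‖f z‖ ≤ b) (z : X) :
    ‖χ z • f z‖ ≤ a * b := by
  by_cases hz : z ∈ K
  · rw [norm_smul, Real.norm_eq_abs]
    exact mul_le_mul (hχ z) (hf z hz) (norm_nonneg _) ha
  · rw [image_eq_zero_of_notMem_tsupport fun h ↦ hz (hs h), zero_smul, norm_zero]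
    positivity

end Cutoff

/-! ### Derivatives of the torus transfer -/

section Deriv

variable {E : Type*} [NormedAddCommGroup E] [NormedSpace ℝ E] {n : ℕ}
  {M : Type*} [TopologicalSpace M] [ChartedSpace E M] [IsManifold 𝓘(ℝ, E) ∞ M]
  {F : Type*} [NormedAddCommGroup F] [NormedSpace ℝ F] {k : ℕ}
  {V : Type*} [NormedAddCommGroup V] [NormedSpace ℝ V]
  {p : M} {A : E ≃L[ℝ] EuclideanSpace ℝ (Fin n)} {ρ : ℝ} (ι : (E [⋀^Fin k]→L[ℝ] F) →L[ℝ] V)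

/-- The inverse cube map has derivative the inverse of the linear part. [folklore] -/
theorem hasFDerivAt_cubeMap_symm (A : E ≃L[ℝ] EuclideanSpace ℝ (Fin n)) (y₀ : E)
    (z : EuclideanSpace ℝ (Fin n)) :
    HasFDerivAt (cubeMap A y₀).symm (A.symm : EuclideanSpace ℝ (Fin n) →L[ℝ] E) z := by
  have h : (cubeMap A y₀).symm = fun z ↦ y₀ + A.symm (-Torus.cubeCenter (Fin n) + z) := rfl
  rw [h]
  exact (((A.symm : EuclideanSpace ℝ (Fin n) →L[ℝ] E).hasFDerivAt).comp z
    ((hasFDerivAt_id z).const_add _)).const_add y₀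

omit [IsManifold 𝓘(ℝ, E) ∞ M] in
/-- **Chain rule for the cube data**: `D(cubeRep β)(z) v = ι (D β̂ (Φ⁻¹ z) (A⁻¹ v))`, for a form
whose cut-off representative is differentiable at `Φ⁻¹ z`. [folklore] -/
theorem MForm.fderiv_cubeRep_apply {β : MForm 𝓘(ℝ, E) M F k} {z : EuclideanSpace ℝ (Fin n)}
    (hβ : DifferentiableAt ℝ (MForm.chartRep p β) ((cubeMap A (extChartAt 𝓘(ℝ, E) p p)).symm z))
    (v : EuclideanSpace ℝ (Fin n)) :
    fderiv ℝ (MForm.cubeRep p A ι β) z v =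
      ι (fderiv ℝ (MForm.chartRep p β) ((cubeMap A (extChartAt 𝓘(ℝ, E) p p)).symm z) (A.symm v)) := by
  have h1 := hasFDerivAt_cubeMap_symm A (extChartAt 𝓘(ℝ, E) p p) z
  have h2 : HasFDerivAt (MForm.cubeRep p A ι β)
      ((ι.comp (fderiv ℝ (MForm.chartRep p β) ((cubeMap A (extChartAt 𝓘(ℝ, E) p p)).symm z))).comp
        (A.symm : EuclideanSpace ℝ (Fin n) →L[ℝ] E)) z :=
    (ι.hasFDerivAt.comp _ hβ.hasFDerivAt).comp z h1
  rw [h2.fderiv]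
  rfl

/-- **Partial derivatives of the torus transfer**: for a smooth form supported in the chart
preimage of `K_ρ` (`ρ < ½`, `K_ρ` inside the target),
`∂_j (T β) (x) = ι (D β̂ (Φ⁻¹ (repr x)) (A⁻¹ e_j))`. [folklore] -/
theorem MForm.partialDeriv_toTorus (hρ : ρ < 1 / 2) {β : MForm 𝓘(ℝ, E) M F k} (hβ : IsSmoothForm β)
    (hKt : cubeRegion A (extChartAt 𝓘(ℝ, E) p p) ρ ⊆ (extChartAt 𝓘(ℝ, E) p).target)
    (hK : ∀ x, β x ≠ 0 → x ∈ (extChartAt 𝓘(ℝ, E) p).source ∧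
      extChartAt 𝓘(ℝ, E) p x ∈ cubeRegion A (extChartAt 𝓘(ℝ, E) p p) ρ)
    (j : Fin n) (x : UnitAddTorus (Fin n)) :
    Torus.partialDeriv j (MForm.toTorus p A ι β) x =
      ι (fderiv ℝ (MForm.chartRep p β) ((cubeMap A (extChartAt 𝓘(ℝ, E) p p)).symm (Torus.repr x))
        (A.symm (EuclideanSpace.single j 1))) := by
  classical
  set g := MForm.cubeRep p A ι β with hg
  have hgs : ContDiff ℝ ∞ g := MForm.contDiff_cubeRep ι hβ hKt hK
  have hgt : tsupport g ⊆ closedBall (Torus.cubeCenter (Fin n)) ρ := MForm.tsupport_cubeRep_subset ι hK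
  have hgR := Torus.tsupport_subset_closedBall_of_openCube (hgt.trans (closedBall_cubeCenter_subset hρ))
  have hT : MForm.toTorus p A ι β = Torus.periodize g := MForm.toTorus_eq_periodize ι hρ hK
  have hsm : Torus.IsSmooth (Torus.periodize g) := Torus.isSmooth_periodize hgs hgR
  rw [hT, Torus.partialDeriv_eq_fderiv_apply (hsm.isContDiff (n := 1) (by simp))]
  conv_lhs => rw [← Torus.proj_repr x]
  rw [← Torus.fderiv_lift, Torus.lift_periodize, Torus.fderiv_perSum (hgs.of_le (by norm_num)) hgR,
    Torus.perSum_eq_self_of_mem_unitCube ?_ (Torus.repr_mem_unitCube x)]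
  · -- chain rule
    have hd : DifferentiableAt ℝ (MForm.chartRep p β)
        ((cubeMap A (extChartAt 𝓘(ℝ, E) p p)).symm (Torus.repr x)) :=
      ((MForm.contDiff_chartRep p (hβ.contDiffOn_inChart_target p) (isCompact_cubeRegion ρ).isClosed
        hKt hK).differentiable (by simp)).differentiableAt
    exact MForm.fderiv_cubeRep_apply ι hd _
  · -- the derivative vanishes off the open cube
    intro y hy
    have hy' : y ∉ tsupport (fderiv ℝ g) := fun h ↦
      hy (closedBall_cubeCenter_subset hρ (hgt (tsupport_fderiv_subset ℝ h)))
    exact image_eq_zero_of_notMem_tsupport hy'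

omit [IsManifold 𝓘(ℝ, E) ∞ M] in
/-- Off the cube region the cut-off representative vanishes identically near the point, so its
derivative vanishes. [folklore] -/
theorem MForm.fderiv_chartRep_eq_zero {β : MForm 𝓘(ℝ, E) M F k}
    (hK : ∀ x, β x ≠ 0 → x ∈ (extChartAt 𝓘(ℝ, E) p).source ∧
      extChartAt 𝓘(ℝ, E) p x ∈ cubeRegion A (extChartAt 𝓘(ℝ, E) p p) ρ)
    {y : E} (hy : y ∉ cubeRegion A (extChartAt 𝓘(ℝ, E) p p) ρ) :
    fderiv ℝ (MForm.chartRep p β) y = 0 := by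
  have hev : MForm.chartRep p β =ᶠ[𝓝 y] fun _ ↦ 0 := by
    filter_upwards [(isCompact_cubeRegion ρ).isClosed.isOpen_compl.mem_nhds hy] with y' hy'
    exact MForm.chartRep_eq_zero p β hK hy'
  rw [hev.fderiv_eq, fderiv_const_apply]

omit [IsManifold 𝓘(ℝ, E) ∞ M] in
/-- On the target the cut-off representative and the representative have the same derivative.
[folklore] -/
theorem MForm.fderiv_chartRep_eq (β : MForm 𝓘(ℝ, E) M F k) {y : E} (hy : y ∈ (extChartAt 𝓘(ℝ, E) p).target) :
    fderiv ℝ (MForm.chartRep p β) y = fderiv ℝ (β.inChart p) y := by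
  refine Filter.EventuallyEq.fderiv_eq ?_
  filter_upwards [(isOpen_extChartAt_target p).mem_nhds hy] with y' hy'
  exact MForm.chartRep_of_mem p β hy'

end Deriv

/-! ### Coordinates and directions of the cube map -/

section Coord

variable {E : Type*} [NormedAddCommGroup E] [NormedSpace ℝ E] {n : ℕ}
  {Λ : Type*} [NormedAddCommGroup Λ] [NormedSpace ℝ Λ]

/-- The `j`-th coordinate functional `ℓ_j = (A ·)_j` of the cube map. [folklore] -/
def cubeCoord (A : E ≃L[ℝ] EuclideanSpace ℝ (Fin n)) (j : Fin n) : E →L[ℝ] ℝ :=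
  (EuclideanSpace.proj j).comp (A : E →L[ℝ] EuclideanSpace ℝ (Fin n))

/-- The `j`-th direction `e_j = A⁻¹ (δ_j)` of the cube map. [folklore] -/
def cubeDir (A : E ≃L[ℝ] EuclideanSpace ℝ (Fin n)) (j : Fin n) : E := A.symm (EuclideanSpace.single j 1)

/-- Unfolding of `cubeCoord`. [folklore] -/
@[simp] theorem cubeCoord_apply (A : E ≃L[ℝ] EuclideanSpace ℝ (Fin n)) (j : Fin n) (v : E) :
    cubeCoord A j v = A v j := rfl

/-- **Expansion of a linear map along the cube coordinates**:
`D = ∑_j ℓ_j ⊗ D(e_j)`. [folklore] -/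
theorem sum_smulRight_cubeCoord (A : E ≃L[ℝ] EuclideanSpace ℝ (Fin n)) (D : E →L[ℝ] Λ) :
    ∑ j, (cubeCoord A j).smulRight (D (cubeDir A j)) = D := by
  classical
  ext v
  have hv : ∑ j, (A v) j • EuclideanSpace.single j (1 : ℝ) = A v := by
    simpa [EuclideanSpace.basisFun_apply, EuclideanSpace.basisFun_repr] using
      (EuclideanSpace.basisFun (Fin n) ℝ).sum_repr (A v)
  calc (∑ j, (cubeCoord A j).smulRight (D (cubeDir A j))) v = ∑ j, (A v) j • D (cubeDir A j) := by
        simp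
    _ = D (A.symm (∑ j, (A v) j • EuclideanSpace.single j (1 : ℝ))) := by
        simp [cubeDir, map_sum, map_smul]
    _ = D v := by rw [hv, ContinuousLinearEquiv.symm_apply_apply]

end Coord

/-! ### The periodic operator of a chart operator -/

section ToFOp1

variable {E : Type*} [NormedAddCommGroup E] [NormedSpace ℝ E] {n : ℕ}
  {M : Type*} [TopologicalSpace M] [ChartedSpace E M] [IsManifold 𝓘(ℝ, E) ∞ M]
  {F F' : Type*} [NormedAddCommGroup F] [NormedSpace ℂ F] [NormedAddCommGroup F'] [NormedSpace ℂ F']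
  {k k' : ℕ}
  {V W : Type*} [NormedAddCommGroup V] [NormedSpace ℂ V] [NormedAddCommGroup W] [NormedSpace ℂ W]

/-- **Cut-off data for the transfer at `p`** (Warner 6.31: `O₀` with `Ō₀ ⊂ V`, and 6.32: cut-off
functions `ω` "identically `1` on `O_n` … with support in `O_{n-1}`"): radii `0 < ρ < ρ' < ½` with
the cube region `K_{ρ'}` inside the chart target, and a smooth cut-off `χ` on `ℝⁿ`, equal to `1`
on `closedBall c₀ ρ`, supported in `closedBall c₀ ρ'`, with `|χ| ≤ 1`. [cite: WarnerGTM94, 6.31] -/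
structure CubeCutoff (p : M) (A : E ≃L[ℝ] EuclideanSpace ℝ (Fin n)) where
  /-- the cut-off function on `ℝⁿ` -/
  χ : EuclideanSpace ℝ (Fin n) → ℝ
  /-- inner radius -/
  ρ : ℝ
  /-- outer radius -/
  ρ' : ℝ
  ρ_pos : 0 < ρ
  ρ_lt : ρ < ρ'
  ρ'_lt : ρ' < 1 / 2
  contDiff : ContDiff ℝ ∞ χ
  eq_one : ∀ z ∈ closedBall (Torus.cubeCenter (Fin n)) ρ, χ z = 1
  tsupport_subset : tsupport χ ⊆ closedBall (Torus.cubeCenter (Fin n)) ρ'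
  abs_le : ∀ z, |χ z| ≤ 1
  region_subset : cubeRegion A (extChartAt 𝓘(ℝ, E) p p) ρ' ⊆ (extChartAt 𝓘(ℝ, E) p).target

namespace CubeCutoff

variable {p : M} {A : E ≃L[ℝ] EuclideanSpace ℝ (Fin n)} (𝒞 : CubeCutoff p A)

omit [IsManifold 𝓘(ℝ, E) ∞ M] in
/-- The inner radius is `< ½`. [folklore] -/
theorem ρ_lt_half : 𝒞.ρ < 1 / 2 := 𝒞.ρ_lt.trans 𝒞.ρ'_lt

omit [IsManifold 𝓘(ℝ, E) ∞ M] in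
/-- The inner cube region lies in the outer one. [folklore] -/
theorem region_mono : cubeRegion A (extChartAt 𝓘(ℝ, E) p p) 𝒞.ρ ⊆ cubeRegion A (extChartAt 𝓘(ℝ, E) p p) 𝒞.ρ' :=
  fun _ hy ↦ closedBall_subset_closedBall 𝒞.ρ_lt.le hy

omit [IsManifold 𝓘(ℝ, E) ∞ M] in
/-- The inner cube region lies in the chart target. [folklore] -/
theorem region_subset' : cubeRegion A (extChartAt 𝓘(ℝ, E) p p) 𝒞.ρ ⊆ (extChartAt 𝓘(ℝ, E) p).target :=
  𝒞.region_mono.trans 𝒞.region_subset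

omit [IsManifold 𝓘(ℝ, E) ∞ M] in
/-- The open set of `ℝⁿ` mapped by `Φ⁻¹` into the chart target. [folklore] -/
theorem isOpen_preimage_target (p : M) (A : E ≃L[ℝ] EuclideanSpace ℝ (Fin n)) :
    IsOpen ((cubeMap A (extChartAt 𝓘(ℝ, E) p p)).symm ⁻¹' (extChartAt 𝓘(ℝ, E) p).target) :=
  (isOpen_extChartAt_target p).preimage (cubeMap A _).symm.continuous

omit [IsManifold 𝓘(ℝ, E) ∞ M] in
/-- The closed support of the cut-off is mapped by `Φ⁻¹` into the chart target. [folklore] -/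
theorem tsupport_subset_preimage :
    tsupport 𝒞.χ ⊆ (cubeMap A (extChartAt 𝓘(ℝ, E) p p)).symm ⁻¹' (extChartAt 𝓘(ℝ, E) p).target :=
  fun z hz ↦ 𝒞.region_subset (by
    rw [mem_cubeRegion_iff, Homeomorph.apply_symm_apply]; exact 𝒞.tsupport_subset hz)

omit [IsManifold 𝓘(ℝ, E) ∞ M] in
/-- The cut-off vanishes off the open unit cube. [folklore] -/
theorem eq_zero_of_not {z : EuclideanSpace ℝ (Fin n)} (hz : ¬ ∀ i, z i ∈ Ioo (0 : ℝ) 1) : 𝒞.χ z = 0 :=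
  image_eq_zero_of_notMem_tsupport fun h ↦ hz (closedBall_cubeCenter_subset 𝒞.ρ'_lt (𝒞.tsupport_subset h))

end CubeCutoff

namespace ChartOp1

variable (Q : ChartOp1 E F F' k k') {p : M} (A : E ≃L[ℝ] EuclideanSpace ℝ (Fin n))
  (ι : (E [⋀^Fin k]→L[ℝ] F) ≃L[ℂ] V) (ι' : (E [⋀^Fin k']→L[ℝ] F') ≃L[ℂ] W)

/-- The real coefficient of `∂_j` at `y`, transported to the torus fibres:
`v ↦ ι' (B y (ℓ_j ⊗ ι⁻¹ v))`. [cite: WarnerGTM94, 6.32] -/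
def dirCoeffR (j : Fin n) (y : E) : V →L[ℝ] W :=
  ((ι' : (E [⋀^Fin k']→L[ℝ] F') →L[ℂ] W).restrictScalars ℝ).comp
    (((Q.B y).comp (ContinuousLinearMap.smulRightL ℝ E (E [⋀^Fin k]→L[ℝ] F) (cubeCoord A j))).comp
      ((ι.symm : V →L[ℂ] (E [⋀^Fin k]→L[ℝ] F)).restrictScalars ℝ))

/-- Values of `dirCoeffR`. [folklore] -/
@[simp] theorem dirCoeffR_apply (j : Fin n) (y : E) (v : V) :
    Q.dirCoeffR A ι ι' j y v = ι' (Q.B y ((cubeCoord A j).smulRight (ι.symm v))) := by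
  simp [dirCoeffR]

/-- The real order-zero coefficient at `y`, transported: `v ↦ ι' (C y (ι⁻¹ v))`. [cite: WarnerGTM94, 6.32] -/
def zeroCoeffR (y : E) : V →L[ℝ] W :=
  ((ι' : (E [⋀^Fin k']→L[ℝ] F') →L[ℂ] W).restrictScalars ℝ).comp
    ((Q.C y).comp ((ι.symm : V →L[ℂ] (E [⋀^Fin k]→L[ℝ] F)).restrictScalars ℝ))

/-- Values of `zeroCoeffR`. [folklore] -/
@[simp] theorem zeroCoeffR_apply (y : E) (v : V) : Q.zeroCoeffR ι ι' y v = ι' (Q.C y (ι.symm v)) := by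
  simp [zeroCoeffR]

variable {Q} in
/-- If `B y` commutes with `i`, so does the transported direction coefficient. [folklore] -/
theorem dirCoeffR_commute (hBI : ∀ y D, Q.B y (Complex.I • D) = Complex.I • Q.B y D) (j : Fin n) (y : E)
    (v : V) : Q.dirCoeffR A ι ι' j y (Complex.I • v) = Complex.I • Q.dirCoeffR A ι ι' j y v := by
  have h1 : (cubeCoord A j).smulRight (ι.symm (Complex.I • v)) =
      Complex.I • (cubeCoord A j).smulRight (ι.symm v) := by
    ext w
    simp only [ContinuousLinearMap.smulRight_apply, FunLike.coe_smul, Pi.smul_apply, map_smul]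
    rw [smul_comm]
  rw [dirCoeffR_apply, dirCoeffR_apply, h1, hBI, map_smul]

variable {Q} in
/-- If `C y` commutes with `i`, so does the transported order-zero coefficient. [folklore] -/
theorem zeroCoeffR_commute (hCI : ∀ y a, Q.C y (Complex.I • a) = Complex.I • Q.C y a) (y : E) (v : V) :
    Q.zeroCoeffR ι ι' y (Complex.I • v) = Complex.I • Q.zeroCoeffR ι ι' y v := by
  rw [zeroCoeffR_apply, zeroCoeffR_apply, map_smul, hCI, map_smul]

/-- The complex direction coefficient. [cite: WarnerGTM94, 6.32] -/
def dirCoeff (hBI : ∀ y D, Q.B y (Complex.I • D) = Complex.I • Q.B y D) (j : Fin n) (y : E) : V →L[ℂ] W :=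
  (Q.dirCoeffR A ι ι' j y).complexOfCommuteI (dirCoeffR_commute A ι ι' hBI j y)

/-- The complex order-zero coefficient. [cite: WarnerGTM94, 6.32] -/
def zeroCoeff (hCI : ∀ y a, Q.C y (Complex.I • a) = Complex.I • Q.C y a) (y : E) : V →L[ℂ] W :=
  (Q.zeroCoeffR ι ι' y).complexOfCommuteI (zeroCoeffR_commute ι ι' hCI y)

/-- Values of `dirCoeff`. [folklore] -/
@[simp] theorem dirCoeff_apply (hBI : ∀ y D, Q.B y (Complex.I • D) = Complex.I • Q.B y D) (j : Fin n)
    (y : E) (v : V) : Q.dirCoeff A ι ι' hBI j y v = ι' (Q.B y ((cubeCoord A j).smulRight (ι.symm v))) := by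
  simp [dirCoeff]

/-- Values of `zeroCoeff`. [folklore] -/
@[simp] theorem zeroCoeff_apply (hCI : ∀ y a, Q.C y (Complex.I • a) = Complex.I • Q.C y a) (y : E) (v : V) :
    Q.zeroCoeff ι ι' hCI y v = ι' (Q.C y (ι.symm v)) := by
  simp [zeroCoeff]

variable {Q A ι ι'}

/-- Smoothness of the real direction coefficient on a set where `B` is smooth. [folklore] -/
theorem contDiffOn_dirCoeffR {s : Set E} (hQ : Q.SmoothOn s) (j : Fin n) :
    ContDiffOn ℝ ∞ (Q.dirCoeffR A ι ι' j) s :=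
  contDiffOn_const.clm_comp ((hQ.1.clm_comp contDiffOn_const).clm_comp contDiffOn_const)

/-- Smoothness of the real order-zero coefficient on a set where `C` is smooth. [folklore] -/
theorem contDiffOn_zeroCoeffR {s : Set E} (hQ : Q.SmoothOn s) : ContDiffOn ℝ ∞ (Q.zeroCoeffR ι ι') s :=
  contDiffOn_const.clm_comp (hQ.2.clm_comp contDiffOn_const)

variable [FiniteDimensional ℂ V] [FiniteDimensional ℂ W]

/-- Smoothness of the complex direction coefficient. [folklore] -/
theorem contDiffOn_dirCoeff {s : Set E} (hQ : Q.SmoothOn s)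
    (hBI : ∀ y D, Q.B y (Complex.I • D) = Complex.I • Q.B y D) (j : Fin n) :
    ContDiffOn ℝ ∞ (Q.dirCoeff A ι ι' hBI j) s :=
  contDiffOn_complexOfCommuteI (contDiffOn_dirCoeffR hQ j) _

/-- Smoothness of the complex order-zero coefficient. [folklore] -/
theorem contDiffOn_zeroCoeff {s : Set E} (hQ : Q.SmoothOn s)
    (hCI : ∀ y a, Q.C y (Complex.I • a) = Complex.I • Q.C y a) :
    ContDiffOn ℝ ∞ (Q.zeroCoeff ι ι' hCI) s :=
  contDiffOn_complexOfCommuteI (contDiffOn_zeroCoeffR hQ) _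

variable (Q A ι ι')

/-- The variable part of the `j`-th coefficient on `ℝⁿ`: the cut-off difference
`χ · (P_j(Φ⁻¹ ·) - P_j(y₀))`. [cite: WarnerGTM94, 6.31] -/
def varCoeffFun (𝒞 : CubeCutoff p A) (hBI : ∀ y D, Q.B y (Complex.I • D) = Complex.I • Q.B y D) (j : Fin n) :
    EuclideanSpace ℝ (Fin n) → (V →L[ℂ] W) := fun z ↦
  𝒞.χ z • (Q.dirCoeff A ι ι' hBI j ((cubeMap A (extChartAt 𝓘(ℝ, E) p p)).symm z) -
    Q.dirCoeff A ι ι' hBI j (extChartAt 𝓘(ℝ, E) p p))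

/-- The order-zero coefficient on `ℝⁿ`: `χ · P₀(Φ⁻¹ ·)`. [cite: WarnerGTM94, 6.31] -/
def zeroCoeffFun (𝒞 : CubeCutoff p A) (hCI : ∀ y a, Q.C y (Complex.I • a) = Complex.I • Q.C y a) :
    EuclideanSpace ℝ (Fin n) → (V →L[ℂ] W) := fun z ↦
  𝒞.χ z • Q.zeroCoeff ι ι' hCI ((cubeMap A (extChartAt 𝓘(ℝ, E) p p)).symm z)

variable {Q A ι ι'}

omit [IsManifold 𝓘(ℝ, E) ∞ M] in
/-- The variable coefficient is smooth on `ℝⁿ`. [folklore] -/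
theorem contDiff_varCoeffFun (𝒞 : CubeCutoff p A) (hQ : Q.SmoothOn (extChartAt 𝓘(ℝ, E) p).target)
    (hBI : ∀ y D, Q.B y (Complex.I • D) = Complex.I • Q.B y D) (j : Fin n) :
    ContDiff ℝ ∞ (Q.varCoeffFun A ι ι' 𝒞 hBI j) := by
  refine contDiff_smul_of_tsupport_subset (CubeCutoff.isOpen_preimage_target p A) 𝒞.contDiff
    𝒞.tsupport_subset_preimage ?_
  exact ((contDiffOn_dirCoeff hQ hBI j).comp (contDiff_cubeMap_symm A _).contDiffOn
    (fun _ hz ↦ hz)).sub contDiffOn_const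

omit [IsManifold 𝓘(ℝ, E) ∞ M] in
/-- The order-zero coefficient is smooth on `ℝⁿ`. [folklore] -/
theorem contDiff_zeroCoeffFun (𝒞 : CubeCutoff p A) (hQ : Q.SmoothOn (extChartAt 𝓘(ℝ, E) p).target)
    (hCI : ∀ y a, Q.C y (Complex.I • a) = Complex.I • Q.C y a) :
    ContDiff ℝ ∞ (Q.zeroCoeffFun A ι ι' 𝒞 hCI) := by
  refine contDiff_smul_of_tsupport_subset (CubeCutoff.isOpen_preimage_target p A) 𝒞.contDiff
    𝒞.tsupport_subset_preimage ?_
  exact (contDiffOn_zeroCoeff hQ hCI).comp (contDiff_cubeMap_symm A _).contDiffOn fun _ hz ↦ hz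

omit [IsManifold 𝓘(ℝ, E) ∞ M] [FiniteDimensional ℂ V] [FiniteDimensional ℂ W] in
/-- The variable coefficient is supported in the closed ball of radius `card`. [folklore] -/
theorem tsupport_varCoeffFun_subset (𝒞 : CubeCutoff p A)
    (hBI : ∀ y D, Q.B y (Complex.I • D) = Complex.I • Q.B y D) (j : Fin n) :
    tsupport (Q.varCoeffFun A ι ι' 𝒞 hBI j) ⊆ closedBall 0 (Fintype.card (Fin n)) :=
  Torus.tsupport_subset_closedBall_of_openCube (((tsupport_smul_subset_left _ _).trans
    𝒞.tsupport_subset).trans (closedBall_cubeCenter_subset 𝒞.ρ'_lt))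

omit [IsManifold 𝓘(ℝ, E) ∞ M] [FiniteDimensional ℂ V] [FiniteDimensional ℂ W] in
/-- The order-zero coefficient is supported in the closed ball of radius `card`. [folklore] -/
theorem tsupport_zeroCoeffFun_subset (𝒞 : CubeCutoff p A)
    (hCI : ∀ y a, Q.C y (Complex.I • a) = Complex.I • Q.C y a) :
    tsupport (Q.zeroCoeffFun A ι ι' 𝒞 hCI) ⊆ closedBall 0 (Fintype.card (Fin n)) :=
  Torus.tsupport_subset_closedBall_of_openCube (((tsupport_smul_subset_left _ _).trans
    𝒞.tsupport_subset).trans (closedBall_cubeCenter_subset 𝒞.ρ'_lt))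

variable (Q A ι ι')

/-- **The periodic first-order operator on the torus attached to a chart operator** (Warner 6.31:
"there exists a periodic elliptic operator `L̃` which agrees with `L` on `O₀`"): constant part the
coefficients frozen at the chart point, variable part the periodised cut-off differences, order-zero
part the periodised cut-off coefficient. [cite: WarnerGTM94, 6.31] -/
def toFOp1 (𝒞 : CubeCutoff p A) (hQ : Q.SmoothOn (extChartAt 𝓘(ℝ, E) p).target)
    (hBI : ∀ y D, Q.B y (Complex.I • D) = Complex.I • Q.B y D)
    (hCI : ∀ y a, Q.C y (Complex.I • a) = Complex.I • Q.C y a) : Torus.FOp1 (Fin n) V W where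
  P j := Q.dirCoeff A ι ι' hBI j (extChartAt 𝓘(ℝ, E) p p)
  p j := Torus.periodize (Q.varCoeffFun A ι ι' 𝒞 hBI j)
  p0 := Torus.periodize (Q.zeroCoeffFun A ι ι' 𝒞 hCI)
  hp j := Torus.isSmooth_periodize (contDiff_varCoeffFun 𝒞 hQ hBI j) (tsupport_varCoeffFun_subset 𝒞 hBI j)
  hp0 := Torus.isSmooth_periodize (contDiff_zeroCoeffFun 𝒞 hQ hCI) (tsupport_zeroCoeffFun_subset 𝒞 hCI)

variable {Q A ι ι'}

omit [IsManifold 𝓘(ℝ, E) ∞ M] in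
/-- The constant coefficients of `toFOp1`. [folklore] -/
@[simp] theorem toFOp1_P (𝒞 : CubeCutoff p A) (hQ : Q.SmoothOn (extChartAt 𝓘(ℝ, E) p).target)
    (hBI : ∀ y D, Q.B y (Complex.I • D) = Complex.I • Q.B y D)
    (hCI : ∀ y a, Q.C y (Complex.I • a) = Complex.I • Q.C y a) (j : Fin n) :
    (Q.toFOp1 A ι ι' 𝒞 hQ hBI hCI).P j = Q.dirCoeff A ι ι' hBI j (extChartAt 𝓘(ℝ, E) p p) := rfl

omit [IsManifold 𝓘(ℝ, E) ∞ M] in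
/-- The variable coefficients of `toFOp1` at `x` are the cut-off differences at `repr x`. [folklore] -/
theorem toFOp1_p_apply (𝒞 : CubeCutoff p A) (hQ : Q.SmoothOn (extChartAt 𝓘(ℝ, E) p).target)
    (hBI : ∀ y D, Q.B y (Complex.I • D) = Complex.I • Q.B y D)
    (hCI : ∀ y a, Q.C y (Complex.I • a) = Complex.I • Q.C y a) (j : Fin n) (x : UnitAddTorus (Fin n)) :
    (Q.toFOp1 A ι ι' 𝒞 hQ hBI hCI).p j x = Q.varCoeffFun A ι ι' 𝒞 hBI j (Torus.repr x) := by
  change Torus.periodize (Q.varCoeffFun A ι ι' 𝒞 hBI j) x = _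
  exact Torus.periodize_eq_apply_repr (fun z hz ↦ by simp [varCoeffFun, 𝒞.eq_zero_of_not hz]) x

omit [IsManifold 𝓘(ℝ, E) ∞ M] in
/-- The order-zero coefficient of `toFOp1` at `x` is the cut-off coefficient at `repr x`. [folklore] -/
theorem toFOp1_p0_apply (𝒞 : CubeCutoff p A) (hQ : Q.SmoothOn (extChartAt 𝓘(ℝ, E) p).target)
    (hBI : ∀ y D, Q.B y (Complex.I • D) = Complex.I • Q.B y D)
    (hCI : ∀ y a, Q.C y (Complex.I • a) = Complex.I • Q.C y a) (x : UnitAddTorus (Fin n)) :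
    (Q.toFOp1 A ι ι' 𝒞 hQ hBI hCI).p0 x = Q.zeroCoeffFun A ι ι' 𝒞 hCI (Torus.repr x) := by
  change Torus.periodize (Q.zeroCoeffFun A ι ι' 𝒞 hCI) x = _
  exact Torus.periodize_eq_apply_repr (fun z hz ↦ by simp [zeroCoeffFun, 𝒞.eq_zero_of_not hz]) x

omit [IsManifold 𝓘(ℝ, E) ∞ M] in
/-- **Smallness of the variable part**: if the derivative coefficient `B` oscillates by at most `δ`
(after transport) on the outer cube region, the variable coefficients of `toFOp1` are bounded by
`δ` everywhere (Warner 6.29 (1): `|b_α| ≤ some c`). [cite: WarnerGTM94, 6.31] -/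
theorem norm_toFOp1_p_le (𝒞 : CubeCutoff p A) (hQ : Q.SmoothOn (extChartAt 𝓘(ℝ, E) p).target)
    (hBI : ∀ y D, Q.B y (Complex.I • D) = Complex.I • Q.B y D)
    (hCI : ∀ y a, Q.C y (Complex.I • a) = Complex.I • Q.C y a) (j : Fin n) {δ : ℝ} (hδ : 0 ≤ δ)
    (hB : ∀ y ∈ cubeRegion A (extChartAt 𝓘(ℝ, E) p p) 𝒞.ρ',
      ‖Q.dirCoeff A ι ι' hBI j y - Q.dirCoeff A ι ι' hBI j (extChartAt 𝓘(ℝ, E) p p)‖ ≤ δ)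
    (x : UnitAddTorus (Fin n)) : ‖(Q.toFOp1 A ι ι' 𝒞 hQ hBI hCI).p j x‖ ≤ δ := by
  rw [toFOp1_p_apply]
  have := norm_smul_le_of_tsupport 𝒞.tsupport_subset zero_le_one hδ 𝒞.abs_le
    (f := fun z ↦ Q.dirCoeff A ι ι' hBI j ((cubeMap A (extChartAt 𝓘(ℝ, E) p p)).symm z) -
      Q.dirCoeff A ι ι' hBI j (extChartAt 𝓘(ℝ, E) p p))
    (fun z hz ↦ hB _ (by rwa [mem_cubeRegion_iff, Homeomorph.apply_symm_apply])) (Torus.repr x)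
  simpa [varCoeffFun] using this

end ChartOp1

/-! ### Agreement with the operator through the transfer -/

section Agreement

variable [FiniteDimensional ℂ V] [FiniteDimensional ℂ W]
  {Q : ChartOp1 E F F' k k'} {p : M} {A : E ≃L[ℝ] EuclideanSpace ℝ (Fin n)}
  {ι : (E [⋀^Fin k]→L[ℝ] F) ≃L[ℂ] V} {ι' : (E [⋀^Fin k']→L[ℝ] F') ≃L[ℂ] W}

/-- **The periodic operator agrees with `op` through the transfer** (Warner 6.31–6.32:
`L̃` agrees with `L` on `O₀`): for a smooth form `β` supported in the chart preimage of the inner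
cube region `K_ρ`, `T (op β) = (Q.toFOp1 …) (T β)`, provided `op` is read by `Q` in the chart at
`p` and maps such forms to forms supported in the same region. [cite: WarnerGTM94, 6.32] -/
theorem ChartOp1.Represents.toTorus_apply (𝒞 : CubeCutoff p A)
    (hQ : Q.SmoothOn (extChartAt 𝓘(ℝ, E) p).target)
    (hBI : ∀ y D, Q.B y (Complex.I • D) = Complex.I • Q.B y D)
    (hCI : ∀ y a, Q.C y (Complex.I • a) = Complex.I • Q.C y a)
    {op : MForm 𝓘(ℝ, E) M F k → MForm 𝓘(ℝ, E) M F' k'} (hrep : ChartOp1.Represents p op Q)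
    (hsupp : ∀ β : MForm 𝓘(ℝ, E) M F k, IsSmoothForm β →
      (∀ x, β x ≠ 0 → x ∈ (extChartAt 𝓘(ℝ, E) p).source ∧
        extChartAt 𝓘(ℝ, E) p x ∈ cubeRegion A (extChartAt 𝓘(ℝ, E) p p) 𝒞.ρ) →
      ∀ x, op β x ≠ 0 → x ∈ (extChartAt 𝓘(ℝ, E) p).source ∧
        extChartAt 𝓘(ℝ, E) p x ∈ cubeRegion A (extChartAt 𝓘(ℝ, E) p p) 𝒞.ρ)
    {β : MForm 𝓘(ℝ, E) M F k} (hβ : IsSmoothForm β)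
    (hK : ∀ x, β x ≠ 0 → x ∈ (extChartAt 𝓘(ℝ, E) p).source ∧
      extChartAt 𝓘(ℝ, E) p x ∈ cubeRegion A (extChartAt 𝓘(ℝ, E) p p) 𝒞.ρ) :
    MForm.toTorus p A ((ι' : (E [⋀^Fin k']→L[ℝ] F') →L[ℂ] W).restrictScalars ℝ) (op β) =
      (Q.toFOp1 A ι ι' 𝒞 hQ hBI hCI).apply
        (MForm.toTorus p A ((ι : (E [⋀^Fin k]→L[ℝ] F) →L[ℂ] V).restrictScalars ℝ) β) := by
  classical
  funext x
  set y₀ := extChartAt 𝓘(ℝ, E) p p with hy₀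
  set z := Torus.repr x with hz
  set y := (cubeMap A y₀).symm z with hy
  have hKρ : cubeRegion A y₀ 𝒞.ρ ⊆ (extChartAt 𝓘(ℝ, E) p).target := 𝒞.region_subset'
  -- the ingredients of both sides at `x`
  have hd : ∀ j, Torus.partialDeriv j
      (MForm.toTorus p A ((ι : (E [⋀^Fin k]→L[ℝ] F) →L[ℂ] V).restrictScalars ℝ) β) x =
        ι (fderiv ℝ (MForm.chartRep p β) y (cubeDir A j)) := fun j ↦
    MForm.partialDeriv_toTorus _ 𝒞.ρ_lt_half hβ hKρ hK j x
  have hv : MForm.toTorus p A ((ι : (E [⋀^Fin k]→L[ℝ] F) →L[ℂ] V).restrictScalars ℝ) β x =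
      ι (MForm.chartRep p β y) := rfl
  have hL : MForm.toTorus p A ((ι' : (E [⋀^Fin k']→L[ℝ] F') →L[ℂ] W).restrictScalars ℝ) (op β) x =
      ι' (MForm.chartRep p (op β) y) := rfl
  have hp : ∀ j, (Q.toFOp1 A ι ι' 𝒞 hQ hBI hCI).p j x =
      𝒞.χ z • (Q.dirCoeff A ι ι' hBI j y - Q.dirCoeff A ι ι' hBI j y₀) := fun j ↦
    ChartOp1.toFOp1_p_apply 𝒞 hQ hBI hCI j x
  have hp0 : (Q.toFOp1 A ι ι' 𝒞 hQ hBI hCI).p0 x = 𝒞.χ z • Q.zeroCoeff ι ι' hCI y :=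
    ChartOp1.toFOp1_p0_apply 𝒞 hQ hBI hCI x
  have hP : ∀ j, (Q.toFOp1 A ι ι' 𝒞 hQ hBI hCI).P j = Q.dirCoeff A ι ι' hBI j y₀ := fun j ↦ rfl
  rw [hL, Torus.FOp1.apply_def]
  simp only [Pi.add_apply, hd, hv, hp, hp0, hP]
  by_cases hzρ : z ∈ closedBall (Torus.cubeCenter (Fin n)) 𝒞.ρ
  · -- inside the inner region: `χ = 1`, `y ∈ K_ρ ⊆ target`
    have hyK : y ∈ cubeRegion A y₀ 𝒞.ρ := by
      rw [mem_cubeRegion_iff, hy, Homeomorph.apply_symm_apply]; exact hzρ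
    have hyt : y ∈ (extChartAt 𝓘(ℝ, E) p).target := hKρ hyK
    have h1 : 𝒞.χ z = 1 := 𝒞.eq_one z hzρ
    have hD : fderiv ℝ (MForm.chartRep p β) y = fderiv ℝ (β.inChart p) y := MForm.fderiv_chartRep_eq β hyt
    have hval : MForm.chartRep p β y = β.inChart p y := MForm.chartRep_of_mem p β hyt
    rw [MForm.chartRep_of_mem p _ hyt, hrep.inChart_eq hβ hyt, ChartOp1.applyAt_def]
    simp only [h1, one_smul, sub_apply, Finset.sum_sub_distrib, ChartOp1.dirCoeff_apply,
      ChartOp1.zeroCoeff_apply, ContinuousLinearEquiv.symm_apply_apply, hD, hval]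
    simp only [← map_sum, sum_smulRight_cubeCoord]
    rw [map_add]
    abel
  · -- outside: everything vanishes
    have hyK : y ∉ cubeRegion A y₀ 𝒞.ρ := by
      rw [mem_cubeRegion_iff, hy, Homeomorph.apply_symm_apply]; exact hzρ
    have h0 : MForm.chartRep p (op β) y = 0 := MForm.chartRep_eq_zero p _ (hsupp β hβ hK) hyK
    have h0' : MForm.chartRep p β y = 0 := MForm.chartRep_eq_zero p _ hK hyK
    have hD : fderiv ℝ (MForm.chartRep p β) y = 0 := MForm.fderiv_chartRep_eq_zero hK hyK
    simp only [h0, h0', hD, map_zero, zero_apply, Finset.sum_const_zero, zero_add]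

end Agreement

end ToFOp1

end Literature.Geometry.Kaehler
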